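import Mathlib.Analysis.InnerProductSpace.PiL2
import Mathlib.Analysis.SpecialFunctions.Pow.Real
import Mathlib.Analysis.SpecialFunctions.Sqrt
import HarnessLib

/-!
# BF18 shell for functions (crux `ChaosClosesEuler`, stmt-AtomisticToContinuum-15141, line `Sketch`,
# stub `stub_bf18Shell`) — helper 4: from coercivity of the clamped relative energy to the `L¹` distance

WHAT. Pointwise algebra turning the two coercivity regimes of the clamped relative energy `X = ℰ_Z` of a state
`(ρ, m, ϑ)` (internal energy `3ρϑ/2`, the monatomic class) against the reference `(r, U, Θ)` into a bound of
the `L¹`-type distance of the CONSERVED variables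
`D = |ρ − r| + ‖m − rU‖ + |‖m‖²/(2ρ) + 3ρϑ/2 − r(‖U‖²/2 + 3Θ/2)|`:

* `l1_dist_le_near` — near the reference (`c((ρ−r)² + (ϑ−Θ)²) + ‖m−ρU‖²/(2ρ) ≤ X`): `D ≤ C (X + √X)`;
* `l1_dist_le_far`  — far from it (`c(1 + ρ + ‖m−ρU‖²/(2ρ) + 3ρϑ/2) ≤ X`): `D ≤ C X`,

with constants depending only on `c` and a common bound `P` of `r, ‖U‖, Θ` (and of `ρ` near the reference).
Integrated over a window `[τ₀, τ₀+Δ] × 𝕋³` and combined with `√X ≤ (λ + X/λ)/2`, these give the shell's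
conclusion `∫∫ D ≤ C(A + √A·…)` from the Grönwall output `∫∫ X ≤ A`.

No named fact is invoked.
-/

noncomputable section

namespace Summit.AtomisticToContinuum.HydrodynamicLimit.Theorems.ChaosClosesEulerShell

open Real

/-- `‖m − ρU‖² = ∑ᵢ (mᵢ − ρUᵢ)²`. [folklore] -/
theorem norm_sub_smul_sq (m U : EuclideanSpace ℝ (Fin 3)) (ρ : ℝ) :
    ‖m - ρ • U‖ ^ 2 = ∑ i, (m i - ρ * U i) ^ 2 := by
  rw [EuclideanSpace.real_norm_sq_eq]
  exact Finset.sum_congr rfl fun i _ => by simp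

/-- The kinetic-energy defect: `|‖m‖²/(2ρ) − ρ‖U‖²/2| ≤ ‖m−ρU‖²/(2ρ) + ‖m − ρU‖ ‖U‖` (`ρ > 0`).
[folklore] -/
theorem abs_kinetic_sub_le (m U : EuclideanSpace ℝ (Fin 3)) {ρ : ℝ} (hρ : 0 < ρ) :
    |‖m‖ ^ 2 / (2 * ρ) - ρ * ‖U‖ ^ 2 / 2| ≤ ‖m - ρ • U‖ ^ 2 / (2 * ρ) + ‖m - ρ • U‖ * ‖U‖ := by
  -- `m = (m - ρU) + ρU`
  set w := m - ρ • U with hw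
  have hm : m = w + ρ • U := by simp [hw]
  have hexp : ‖m‖ ^ 2 = ‖w‖ ^ 2 + 2 * (ρ * inner ℝ w U) + ρ ^ 2 * ‖U‖ ^ 2 := by
    rw [hm, norm_add_sq_real, real_inner_smul_right, norm_smul, Real.norm_eq_abs, abs_of_pos hρ]
    ring
  have hdiff : ‖m‖ ^ 2 / (2 * ρ) - ρ * ‖U‖ ^ 2 / 2 = ‖w‖ ^ 2 / (2 * ρ) + inner ℝ w U := by
    rw [hexp]; field_simp; ring
  rw [hdiff]
  have hcs : |inner ℝ w U| ≤ ‖w‖ * ‖U‖ := abs_real_inner_le_norm w U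
  have h0 : 0 ≤ ‖w‖ ^ 2 / (2 * ρ) := by positivity
  calc |‖w‖ ^ 2 / (2 * ρ) + inner ℝ w U| ≤ |‖w‖ ^ 2 / (2 * ρ)| + |inner ℝ w U| := abs_add_le _ _
    _ ≤ ‖w‖ ^ 2 / (2 * ρ) + ‖w‖ * ‖U‖ := by rw [abs_of_nonneg h0]; linarith

/-- `‖m − rU‖ ≤ ‖m − ρU‖ + |ρ − r| ‖U‖`. [folklore] -/
theorem norm_sub_ref_le (m U : EuclideanSpace ℝ (Fin 3)) (ρ r : ℝ) :
    ‖m - r • U‖ ≤ ‖m - ρ • U‖ + |ρ - r| * ‖U‖ := by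
  have : m - r • U = (m - ρ • U) + (ρ - r) • U := by
    rw [sub_smul]; abel
  rw [this]
  calc ‖(m - ρ • U) + (ρ - r) • U‖ ≤ ‖m - ρ • U‖ + ‖(ρ - r) • U‖ := norm_add_le _ _
    _ = ‖m - ρ • U‖ + |ρ - r| * ‖U‖ := by rw [norm_smul, Real.norm_eq_abs]

/-- `√(a b) ≤ (a + b)/2`-type bound: `‖m − ρU‖ = √(2ρ · K) ≤ ρ + K/2` where `K = ‖m−ρU‖²/(2ρ)`.
[folklore] -/
theorem norm_sub_smul_le_lin (m U : EuclideanSpace ℝ (Fin 3)) {ρ : ℝ} (hρ : 0 < ρ) :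
    ‖m - ρ • U‖ ≤ ρ + ‖m - ρ • U‖ ^ 2 / (2 * ρ) / 2 := by
  have h : ‖m - ρ • U‖ ^ 2 / (2 * ρ) / 2 = ‖m - ρ • U‖ ^ 2 / (4 * ρ) := by ring
  rw [h]
  have key : 0 ≤ (‖m - ρ • U‖ - 2 * ρ) ^ 2 / (4 * ρ) := by positivity
  have e : (‖m - ρ • U‖ - 2 * ρ) ^ 2 / (4 * ρ) = ‖m - ρ • U‖ ^ 2 / (4 * ρ) - ‖m - ρ • U‖ + ρ := by
    field_simp; ring
  linarith [e ▸ key]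

/-- **Near the reference state.** If `0 < ρ ≤ P`, `0 ≤ Θ ≤ P`, `‖U‖ ≤ P`, `0 < c`, `0 ≤ X` and
`c((ρ−r)² + (ϑ−Θ)²) + ‖m−ρU‖²/(2ρ) ≤ X`, then
`|ρ−r| + ‖m − rU‖ + |‖m‖²/(2ρ) + 3ρϑ/2 − r(‖U‖²/2 + 3Θ/2)| ≤ (1 + (1 + 4P + P²/2)/√c + (1+P)√(2P)) (X + √X)`.
[folklore] -/
theorem l1_dist_le_near (m U : EuclideanSpace ℝ (Fin 3)) {ρ r ϑ Θ P c X : ℝ} (hρ : 0 < ρ) (hρP : ρ ≤ P)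
    (hΘ0 : 0 ≤ Θ) (hΘP : Θ ≤ P) (hUP : ‖U‖ ≤ P) (hc : 0 < c) (hX : 0 ≤ X)
    (hnear : c * ((ρ - r) ^ 2 + (ϑ - Θ) ^ 2) + ‖m - ρ • U‖ ^ 2 / (2 * ρ) ≤ X) :
    |ρ - r| + ‖m - r • U‖ + |‖m‖ ^ 2 / (2 * ρ) + 3 / 2 * ρ * ϑ - r * (‖U‖ ^ 2 / 2 + 3 / 2 * Θ)| ≤
      (1 + (1 + 4 * P + P ^ 2 / 2) / Real.sqrt c + (1 + P) * Real.sqrt (2 * P)) * (X + Real.sqrt X) := by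
  have hP0 : 0 ≤ P := hρ.le.trans hρP
  have hU0 : 0 ≤ ‖U‖ := norm_nonneg _
  set K := ‖m - ρ • U‖ ^ 2 / (2 * ρ) with hK
  have hK0 : 0 ≤ K := by positivity
  have hKX : K ≤ X := by nlinarith [sq_nonneg (ρ - r), sq_nonneg (ϑ - Θ)]
  have hsc : 0 < Real.sqrt c := Real.sqrt_pos.2 hc
  have hsX : 0 ≤ Real.sqrt X := Real.sqrt_nonneg _
  -- `|ρ - r|, |ϑ - Θ| ≤ √X/√c`
  have hsq : ∀ y : ℝ, c * y ^ 2 ≤ X → |y| ≤ Real.sqrt X / Real.sqrt c := fun y hy => by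
    rw [le_div_iff₀ hsc, ← Real.sqrt_sq (abs_nonneg y), ← Real.sqrt_mul (sq_nonneg _)]
    refine Real.sqrt_le_sqrt ?_
    rw [sq_abs]; linarith
  have hρr : |ρ - r| ≤ Real.sqrt X / Real.sqrt c :=
    hsq _ (by nlinarith [sq_nonneg (ϑ - Θ)])
  have hϑΘ : |ϑ - Θ| ≤ Real.sqrt X / Real.sqrt c :=
    hsq _ (by nlinarith [sq_nonneg (ρ - r)])
  -- `‖m - ρU‖ ≤ √(2P) √X`
  have hw : ‖m - ρ • U‖ ≤ Real.sqrt (2 * P) * Real.sqrt X := by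
    rw [← Real.sqrt_mul (by positivity), ← Real.sqrt_sq (norm_nonneg (m - ρ • U))]
    refine Real.sqrt_le_sqrt ?_
    have h1 : ‖m - ρ • U‖ ^ 2 = 2 * ρ * K := by simp only [hK]; field_simp
    rw [h1]
    have := mul_le_mul (mul_le_mul_of_nonneg_left hρP (by norm_num : (0 : ℝ) ≤ 2)) hKX hK0 (by positivity)
    linarith
  -- the three pieces
  have h1 : ‖m - r • U‖ ≤ Real.sqrt (2 * P) * Real.sqrt X + Real.sqrt X / Real.sqrt c * P :=
    (norm_sub_ref_le m U ρ r).trans (add_le_add hw (mul_le_mul hρr hUP hU0 (by positivity)))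
  have h2 : |‖m‖ ^ 2 / (2 * ρ) + 3 / 2 * ρ * ϑ - r * (‖U‖ ^ 2 / 2 + 3 / 2 * Θ)| ≤
      (K + Real.sqrt (2 * P) * Real.sqrt X * P) + P ^ 2 / 2 * (Real.sqrt X / Real.sqrt c) +
        3 / 2 * (P * (Real.sqrt X / Real.sqrt c) + P * (Real.sqrt X / Real.sqrt c)) := by
    have e : ‖m‖ ^ 2 / (2 * ρ) + 3 / 2 * ρ * ϑ - r * (‖U‖ ^ 2 / 2 + 3 / 2 * Θ) =
        (‖m‖ ^ 2 / (2 * ρ) - ρ * ‖U‖ ^ 2 / 2) + (ρ - r) * (‖U‖ ^ 2 / 2) +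
          3 / 2 * (ρ * (ϑ - Θ) + Θ * (ρ - r)) := by ring
    rw [e]
    have a1 : |‖m‖ ^ 2 / (2 * ρ) - ρ * ‖U‖ ^ 2 / 2| ≤ K + Real.sqrt (2 * P) * Real.sqrt X * P :=
      (abs_kinetic_sub_le m U hρ).trans (add_le_add le_rfl (mul_le_mul hw hUP hU0 (by positivity)))
    have a2 : |(ρ - r) * (‖U‖ ^ 2 / 2)| ≤ Real.sqrt X / Real.sqrt c * (P ^ 2 / 2) := by
      rw [abs_mul, abs_of_nonneg (by positivity : (0 : ℝ) ≤ ‖U‖ ^ 2 / 2)]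
      refine mul_le_mul hρr ?_ (by positivity) (by positivity)
      have := mul_le_mul hUP hUP hU0 hP0
      nlinarith
    have a3 : |3 / 2 * (ρ * (ϑ - Θ) + Θ * (ρ - r))| ≤
        3 / 2 * (P * (Real.sqrt X / Real.sqrt c) + P * (Real.sqrt X / Real.sqrt c)) := by
      rw [abs_mul, abs_of_pos (by norm_num : (0 : ℝ) < 3 / 2)]
      refine mul_le_mul_of_nonneg_left ((abs_add_le _ _).trans (add_le_add ?_ ?_)) (by norm_num)
      · rw [abs_mul, abs_of_pos hρ]; exact mul_le_mul hρP hϑΘ (abs_nonneg _) hP0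
      · rw [abs_mul, abs_of_nonneg hΘ0]; exact mul_le_mul hΘP hρr (abs_nonneg _) hP0
    calc _ ≤ |‖m‖ ^ 2 / (2 * ρ) - ρ * ‖U‖ ^ 2 / 2 + (ρ - r) * (‖U‖ ^ 2 / 2)| +
          |3 / 2 * (ρ * (ϑ - Θ) + Θ * (ρ - r))| := abs_add_le _ _
      _ ≤ (|‖m‖ ^ 2 / (2 * ρ) - ρ * ‖U‖ ^ 2 / 2| + |(ρ - r) * (‖U‖ ^ 2 / 2)|) +
          |3 / 2 * (ρ * (ϑ - Θ) + Θ * (ρ - r))| := by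
            linarith [abs_add_le (‖m‖ ^ 2 / (2 * ρ) - ρ * ‖U‖ ^ 2 / 2) ((ρ - r) * (‖U‖ ^ 2 / 2))]
      _ ≤ _ := by linarith
  -- collect: everything is `≤ X + √X · (…)`
  have hsum : |ρ - r| + ‖m - r • U‖ + |‖m‖ ^ 2 / (2 * ρ) + 3 / 2 * ρ * ϑ - r * (‖U‖ ^ 2 / 2 + 3 / 2 * Θ)|
      ≤ X + Real.sqrt X * ((1 + 4 * P + P ^ 2 / 2) / Real.sqrt c + (1 + P) * Real.sqrt (2 * P)) := by
    have e : X + Real.sqrt X * ((1 + 4 * P + P ^ 2 / 2) / Real.sqrt c + (1 + P) * Real.sqrt (2 * P)) =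
        Real.sqrt X / Real.sqrt c + (Real.sqrt (2 * P) * Real.sqrt X + Real.sqrt X / Real.sqrt c * P) +
        ((X + Real.sqrt (2 * P) * Real.sqrt X * P) + P ^ 2 / 2 * (Real.sqrt X / Real.sqrt c) +
          3 / 2 * (P * (Real.sqrt X / Real.sqrt c) + P * (Real.sqrt X / Real.sqrt c))) := by
      field_simp; ring
    rw [e]; linarith
  refine hsum.trans ?_
  have hB0 : 0 ≤ (1 + 4 * P + P ^ 2 / 2) / Real.sqrt c + (1 + P) * Real.sqrt (2 * P) := by positivity
  have e2 : (1 + ((1 + 4 * P + P ^ 2 / 2) / Real.sqrt c + (1 + P) * Real.sqrt (2 * P))) * (X + Real.sqrt X) =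
      X + Real.sqrt X * ((1 + 4 * P + P ^ 2 / 2) / Real.sqrt c + (1 + P) * Real.sqrt (2 * P)) +
        (Real.sqrt X + X * ((1 + 4 * P + P ^ 2 / 2) / Real.sqrt c + (1 + P) * Real.sqrt (2 * P))) := by ring
  rw [show (1 + (1 + 4 * P + P ^ 2 / 2) / Real.sqrt c + (1 + P) * Real.sqrt (2 * P)) =
    (1 + ((1 + 4 * P + P ^ 2 / 2) / Real.sqrt c + (1 + P) * Real.sqrt (2 * P))) by ring, e2]
  have : 0 ≤ Real.sqrt X + X * ((1 + 4 * P + P ^ 2 / 2) / Real.sqrt c + (1 + P) * Real.sqrt (2 * P)) := by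
    positivity
  linarith

/-- **Far from the reference state.** If `0 < ρ`, `0 ≤ ϑ`, `0 ≤ r, Θ, ‖U‖ ≤ P`, `0 < c` and
`c(1 + ρ + ‖m−ρU‖²/(2ρ) + 3ρϑ/2) ≤ X`, then
`|ρ−r| + ‖m − rU‖ + |‖m‖²/(2ρ) + 3ρϑ/2 − r(‖U‖²/2 + 3Θ/2)| ≤ (3 + P + 3P² + P³)/c · X`. [folklore] -/
theorem l1_dist_le_far (m U : EuclideanSpace ℝ (Fin 3)) {ρ r ϑ Θ P c X : ℝ} (hρ : 0 < ρ) (hϑ : 0 ≤ ϑ)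
    (hr0 : 0 ≤ r) (hrP : r ≤ P) (hΘ0 : 0 ≤ Θ) (hΘP : Θ ≤ P) (hUP : ‖U‖ ≤ P) (hc : 0 < c)
    (hfar : c * (1 + ρ + ‖m - ρ • U‖ ^ 2 / (2 * ρ) + 3 / 2 * ρ * ϑ) ≤ X) :
    |ρ - r| + ‖m - r • U‖ + |‖m‖ ^ 2 / (2 * ρ) + 3 / 2 * ρ * ϑ - r * (‖U‖ ^ 2 / 2 + 3 / 2 * Θ)| ≤
      (3 + P + 3 * P ^ 2 + P ^ 3) / c * X := by
  have hP0 : 0 ≤ P := hr0.trans hrP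
  have hU0 : 0 ≤ ‖U‖ := norm_nonneg _
  set K := ‖m - ρ • U‖ ^ 2 / (2 * ρ) with hK
  have hK0 : 0 ≤ K := by positivity
  set G := 1 + ρ + K + 3 / 2 * ρ * ϑ with hG
  have hGX : G ≤ X / c := by rw [le_div_iff₀ hc, mul_comm]; exact hfar
  have hE0 : 0 ≤ 3 / 2 * ρ * ϑ := by positivity
  -- pieces
  have h1 : |ρ - r| ≤ ρ + P := (abs_sub _ _).trans (by rw [abs_of_pos hρ, abs_of_nonneg hr0]; linarith)
  have hw : ‖m - ρ • U‖ ≤ ρ + K / 2 := norm_sub_smul_le_lin m U hρ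
  have h2 : ‖m - r • U‖ ≤ ρ + K / 2 + (ρ + P) * P :=
    (norm_sub_ref_le m U ρ r).trans (add_le_add hw (mul_le_mul h1 hUP hU0 (by positivity)))
  have hkin : ‖m‖ ^ 2 / (2 * ρ) ≤ 2 * K + ρ * ‖U‖ ^ 2 := by
    have hm : m = (m - ρ • U) + ρ • U := by abel
    have h3 : ‖m‖ ^ 2 ≤ 2 * ‖m - ρ • U‖ ^ 2 + 2 * (ρ * ‖U‖) ^ 2 := by
      have := norm_add_le (m - ρ • U) (ρ • U)
      rw [← hm, norm_smul, Real.norm_eq_abs, abs_of_pos hρ] at this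
      nlinarith [sq_nonneg (‖m - ρ • U‖ - ρ * ‖U‖), norm_nonneg (m - ρ • U), norm_nonneg m]
    calc ‖m‖ ^ 2 / (2 * ρ) ≤ (2 * ‖m - ρ • U‖ ^ 2 + 2 * (ρ * ‖U‖) ^ 2) / (2 * ρ) :=
          div_le_div_of_nonneg_right h3 (by positivity)
      _ = 2 * K + ρ * ‖U‖ ^ 2 := by simp only [hK]; field_simp
  have h3 : |‖m‖ ^ 2 / (2 * ρ) + 3 / 2 * ρ * ϑ - r * (‖U‖ ^ 2 / 2 + 3 / 2 * Θ)| ≤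
      (2 * K + ρ * P ^ 2 + 3 / 2 * ρ * ϑ) + P * (P ^ 2 / 2 + 3 / 2 * P) := by
    have hUU : ‖U‖ ^ 2 ≤ P ^ 2 := pow_le_pow_left₀ hU0 hUP 2
    have ha : 0 ≤ ‖m‖ ^ 2 / (2 * ρ) + 3 / 2 * ρ * ϑ := by positivity
    have hb : 0 ≤ r * (‖U‖ ^ 2 / 2 + 3 / 2 * Θ) := by positivity
    have hb' : r * (‖U‖ ^ 2 / 2 + 3 / 2 * Θ) ≤ P * (P ^ 2 / 2 + 3 / 2 * P) :=
      mul_le_mul hrP (by nlinarith) (by positivity) hP0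
    have hρU : ρ * ‖U‖ ^ 2 ≤ ρ * P ^ 2 := mul_le_mul_of_nonneg_left hUU hρ.le
    rw [abs_le]; constructor <;> nlinarith
  -- collect
  have hsum : |ρ - r| + ‖m - r • U‖ + |‖m‖ ^ 2 / (2 * ρ) + 3 / 2 * ρ * ϑ - r * (‖U‖ ^ 2 / 2 + 3 / 2 * Θ)|
      ≤ (3 + P + 3 * P ^ 2 + P ^ 3) * G := by
    have e : (3 + P + 3 * P ^ 2 + P ^ 3) * G =
        (3 + P + 3 * P ^ 2 + P ^ 3) * 1 + (3 + P + 3 * P ^ 2 + P ^ 3) * ρ +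
          (3 + P + 3 * P ^ 2 + P ^ 3) * K + (3 + P + 3 * P ^ 2 + P ^ 3) * (3 / 2 * ρ * ϑ) := by
      simp only [hG]; ring
    rw [e]
    nlinarith [mul_nonneg hP0 hρ.le, mul_nonneg (sq_nonneg P) hρ.le, mul_nonneg (sq_nonneg P) hK0,
      mul_nonneg hP0 hK0, pow_nonneg hP0 3, mul_nonneg (pow_nonneg hP0 3) hρ.le,
      mul_nonneg (pow_nonneg hP0 3) hK0, mul_nonneg hP0 hE0, mul_nonneg (sq_nonneg P) hE0,
      mul_nonneg (pow_nonneg hP0 3) hE0]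
  calc _ ≤ (3 + P + 3 * P ^ 2 + P ^ 3) * G := hsum
    _ ≤ (3 + P + 3 * P ^ 2 + P ^ 3) * (X / c) := mul_le_mul_of_nonneg_left hGX (by positivity)
    _ = (3 + P + 3 * P ^ 2 + P ^ 3) / c * X := by field_simp

/-- REGISTERED SUB-GOAL `stub_bf18ShellL1` of the line `Sketch` (helper 4 of `stub_bf18Shell`): the far-field
`L¹` conversion. [folklore] -/
theorem stub_bf18ShellL1 :
    ∀ (m U : EuclideanSpace ℝ (Fin 3)) (ρ r ϑ Θ P c X : ℝ), 0 < ρ → 0 ≤ ϑ → 0 ≤ r → r ≤ P → 0 ≤ Θ → Θ ≤ P →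
      ‖U‖ ≤ P → 0 < c → c * (1 + ρ + ‖m - ρ • U‖ ^ 2 / (2 * ρ) + 3 / 2 * ρ * ϑ) ≤ X →
      |ρ - r| + ‖m - r • U‖ + |‖m‖ ^ 2 / (2 * ρ) + 3 / 2 * ρ * ϑ - r * (‖U‖ ^ 2 / 2 + 3 / 2 * Θ)| ≤
        (3 + P + 3 * P ^ 2 + P ^ 3) / c * X :=
  fun m U _ρ _r _ϑ _Θ _P _c _X hρ hϑ hr0 hrP hΘ0 hΘP hUP hc hfar =>
    l1_dist_le_far m U hρ hϑ hr0 hrP hΘ0 hΘP hUP hc hfar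

end Summit.AtomisticToContinuum.HydrodynamicLimit.Theorems.ChaosClosesEulerShell
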